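import Literature.MathematicalPhysics.QuantumFieldTheory.BalabanImbrieJaffe1984to88.BIJ88ActInLastCube309

/-!
# `BalabanImbrieJaffe1984to88.BIJ88ActInLastCubeSupp309` — T. Bałaban, J. Imbrie, A. Jaffe, *Effective action and cluster properties of the abelian
Higgs model*, Commun. Math. Phys. **114** (1988) 257–315 [BalabanImbrieJaffe1988], Sect. 5.14 (5.14.3)–(5.14.4) p. 309 [PDF 53] with Sect. 5.13
(5.13.3) p. 305–306 [PDF 49–50]: **THE LOCATED ACTIVITY COSTS ONE `s`-DERIVATIVE — WITH THE DERIVATIVE BOUND NEEDED ONLY ABOVE THE POLYMER** —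
the volume-uniform form of p36 g18's capstone `BIJ88ActInLastCube309.abs_actIn_le_of_dexp_bound`: the corners `1_Λ′`, `Λ′ ⊆ X″`, and the segments
`1_Λ′[n ↦ σ]` along which (5.13.3) integrates all have their support in `X″`, so the bound `B` on p13's first derivative `∂{n}⟨Π_{□_i⊂X″} fD_i⟩(s)` is
needed only for `s ∈ [0,1]^I` SUPPORTED IN `X″` (there the precision `Δ_s` decouples every cube off `X″`, so every letter feeding `B` — drift,
moments, boundary operator of `BIJ88DexpCondMeanMajorant305` — sees the fields and the source of `X″` only).  Also the order-one derivative is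
insensitive to constants: `∂{n}⟨H − c⟩ = ∂{n}⟨H⟩` (used with `c = 1` on vacuum polymers, where `H − 1` is small).

statement-level skeleton of published theorems with citation tags; proofs where landed; nothing here is a claim about the Yang–Mills mass gap

PDF held: `paper:balaban1988-cmp114-bij-abelian-higgs-effective-action` (journal page = PDF page + 256); p. 309 (p0053.txt L14–16), verbatim: *"The
proof of this estimate is similar to the one for g₂. We mention only the new features."*; p. 305: *"the first derivative produces a term
⟨Σ_{j≠i} s_j⟨□_iΦ, Δ□_jΦ⟩; Π f(□_i)⟩_{s_Γ}"*.

WHAT IS PROVED (unit `lit-balaban-p36`, generation 19 of the Phase-2 proof seat p36; SKELETON rows C2.Eq5.14.3-5.14.4 / C2.Eq5.13.3-5.13.4 of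
`HOME/lit-balaban-r16/ROWS-C2-part2.md`, owner r16; 0 definitions, 0 `Prop` facts, theorems only).
* `dexp_singleton_sub_const` (`∂{n}⟨H − c⟩(s) = ∂{n}⟨H⟩(s)`), `update_corner_supp` (the segments above the corners of `X″ ∖ {n}` are supported
  in `X″`), **`abs_cornerSum_zG_univ_le_supp`**, **`abs_cornerSum_zG_le_supp`**, **`abs_actIn_le_of_dexp_bound_supp`** — g18's three last-cube
  bounds with the hypothesis `hB` restricted to `s` supported in the polymer.
HONEST SCOPE: bookkeeping; no estimate.  Imports `BIJ88ActInLastCube309` (p36 g18); modifies nothing.  NOT summit progress; NOT continuum; NOT Clay.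
Cell `lit-balaban` Phase 2, seat p36 gen 19 (owner r16, referee ref-5).
-/

noncomputable section

open Finset MeasureTheory Matrix Function Filter Set
open Literature.MathematicalPhysics.QuantumFieldTheory.Balaban1983to89
open Literature.MathematicalPhysics.QuantumFieldTheory.BalabanImbrieJaffe1984to88
open BIJ88Sect5Statements (CutoffProfile)
open BIJ88DirichletForms305 (interpForm)
open BIJ88Clusters5134 (cornerSum act)
open BIJ88PolymerRep5134 (g1_of_two_le IsConn corner corner_apply)
open BIJ88PolymerRep5134Gauss (zG)
open BIJ88Expansion5143 (g3 prime prime_of_not)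
open BIJ88Expansion5143Gauss (fD)
open BIJ88SlotMomentsGauss308 (uD)
open BIJ88Eq5145CornerModel (slotB slotY)
open BIJ88Eq5145CornerUrsell (cubeIn)
open BIJ88W6PrimeVsupp (actIn)
open BIJ88SecondOrder5133 (num)
open BIJ88CumulantAllOrders5133 (dexp dexp_singleton)
open BIJ88CornerSumLastCube309 (abs_cornerSum_corner_le_of_hasDerivAt)
open BIJ88RegionLawUniv309 (hasDerivAt_zG_univ_update)
open BIJ88RegionCornerReduction309 (cornerSum_zG_eq_univ_extend)

namespace Literature.MathematicalPhysics.QuantumFieldTheory.BalabanImbrieJaffe1984to88.BIJ88ActInLastCubeSupp309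

variable {α I : Type} [Fintype α] [DecidableEq α] [Fintype I] [DecidableEq I] (blk : α → I) (Δ : Matrix α α ℝ) (ℱ : α → ℝ)

/-! ## §1 Constants do not contribute to `∂{n}⟨·⟩` -/

/-- **`∂{n}⟨H − c⟩(s) = ∂{n}⟨H⟩(s)`** (the truncation kills constants), provided `D_n H` and `D_n` are integrable against the weight (as they are for
bounded measurable `H` on the cube). [cite: BalabanImbrieJaffe1988, §5.13 p.305] -/
theorem dexp_singleton_sub_const (H : (α → ℝ) → ℝ) (c : ℝ) (n : I) (s : I → ℝ)
    (hZ : num blk Δ ℱ (fun _ => (1 : ℝ)) s ≠ 0)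
    (hDH : Integrable fun φ : α → ℝ => BIJ88SecondOrder5133.Dfun blk Δ s n φ * H φ *
      (B2Eq228Conditioning.weight (interpForm blk Δ s) φ * B2Eq228Conditioning.source ℱ φ))
    (hD : Integrable fun φ : α → ℝ => BIJ88SecondOrder5133.Dfun blk Δ s n φ *
      (B2Eq228Conditioning.weight (interpForm blk Δ s) φ * B2Eq228Conditioning.source ℱ φ))
    (hH : Integrable fun φ : α → ℝ => H φ * (B2Eq228Conditioning.weight (interpForm blk Δ s) φ * B2Eq228Conditioning.source ℱ φ)) :
    dexp blk Δ ℱ (fun φ => H φ - c) {n} s = dexp blk Δ ℱ H {n} s := by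
  rw [dexp_singleton, dexp_singleton]
  have h1 : num blk Δ ℱ (fun φ => BIJ88SecondOrder5133.Dfun blk Δ s n φ * (H φ - c)) s
      = num blk Δ ℱ (fun φ => BIJ88SecondOrder5133.Dfun blk Δ s n φ * H φ) s - c * num blk Δ ℱ (BIJ88SecondOrder5133.Dfun blk Δ s n) s := by
    simp only [num]
    rw [← integral_const_mul, ← integral_sub hDH (hD.const_mul c)]
    refine integral_congr_ae (Eventually.of_forall fun φ => ?_)
    simp only; ring
  have h2 : num blk Δ ℱ (fun φ => H φ - c) s = num blk Δ ℱ H s - c * num blk Δ ℱ (fun _ => (1 : ℝ)) s := by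
    simp only [num, one_mul]
    rw [← integral_const_mul]
    have hc : Integrable fun φ : α → ℝ => c * (B2Eq228Conditioning.weight (interpForm blk Δ s) φ * B2Eq228Conditioning.source ℱ φ) := by
      by_cases hpd : Integrable (fun φ : α → ℝ => B2Eq228Conditioning.weight (interpForm blk Δ s) φ * B2Eq228Conditioning.source ℱ φ)
      · exact hpd.const_mul c
      · exfalso; apply hZ; simp only [num, one_mul]; exact integral_undef hpd
    rw [← integral_sub hH hc]
    refine integral_congr_ae (Eventually.of_forall fun φ => ?_)
    simp only; ring
  rw [h1, h2]
  field_simp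
  ring

/-! ## §2 The last-cube bounds with the derivative bound above the polymer only -/

omit [Fintype I] in
/-- the segment `1_Λ[n ↦ σ]`, `Λ ⊆ Γ ∖ {n}`, `σ ∈ [0,1]`, lies in the cube and is supported in `Γ`. [cite: BalabanImbrieJaffe1988, (5.13.3) p.305] -/
theorem update_corner_supp {Γ Λ : Finset I} {n : I} (hn : n ∈ Γ) (hΛ : Λ ⊆ Γ.erase n) {σ : ℝ} (hσ : σ ∈ Icc (0 : ℝ) 1) :
    (∀ i, 0 ≤ update (corner ℝ Λ) n σ i ∧ update (corner ℝ Λ) n σ i ≤ 1) ∧ (∀ i, i ∉ Γ → update (corner ℝ Λ) n σ i = 0) := by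
  refine ⟨fun i => ?_, fun i hi => ?_⟩
  · by_cases hin : i = n
    · subst hin; simpa using hσ
    · rw [update_of_ne hin, corner_apply]; split_ifs <;> norm_num
  · have hin : i ≠ n := fun h => hi (h ▸ hn)
    have hiΛ : i ∉ Λ := fun h => hi (Finset.mem_of_mem_erase (hΛ h))
    rw [update_of_ne hin, corner_apply, if_neg hiΛ]

section LastCube

variable {Δ} (hΔ : Δ.PosDef) {c C : ℝ} (hc : 0 < c) (hcΔ : ∀ v, c * (v ⬝ᵥ v) ≤ v ⬝ᵥ (Δ *ᵥ v)) (hCΔ : ∀ v, v ⬝ᵥ (Δ *ᵥ v) ≤ C * (v ⬝ᵥ v))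

include hΔ hc hcΔ hCΔ in
/-- **last-cube bound on the full region, `B` needed only above `Γ`**: as `BIJ88RegionLawUniv309.abs_cornerSum_zG_univ_le`, with the derivative
bound required only at the points of `[0,1]^I` supported in `Γ`. [cite: BalabanImbrieJaffe1988, (5.13.3) p.305; (5.14.3) p.309] -/
theorem abs_cornerSum_zG_univ_le_supp {f : I → (α → ℝ) → ℝ} (hfm : AEStronglyMeasurable (fun ψ : α → ℝ => ∏ i, f i ψ) volume)
    {K₀ : ℝ} (hK : ∀ ψ : α → ℝ, ‖∏ i, f i ψ‖ ≤ K₀) {Γ : Finset I} {n : I} (hn : n ∈ Γ) {B : ℝ}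
    (hB : ∀ s : I → ℝ, (∀ l, 0 ≤ s l ∧ s l ≤ 1) → (∀ l, l ∉ Γ → s l = 0) → |dexp blk Δ ℱ (fun ψ => ∏ i, f i ψ) {n} s| ≤ B) :
    |cornerSum (zG blk Δ ℱ f (univ : Finset I)) Γ| ≤ 2 ^ (Γ.card - 1) * B := by
  refine abs_cornerSum_corner_le_of_hasDerivAt (g := BIJ88PolymerRep5134Gauss.expect blk Δ ℱ f (univ : Finset I))
    (g' := dexp blk Δ ℱ (fun ψ => ∏ i, f i ψ) {n}) hn (fun Λ hΛ σ hσ => ?_) (fun Λ hΛ σ hσ => ?_)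
  · have h := hasDerivAt_zG_univ_update blk ℱ hΔ hc hcΔ hCΔ hfm hK (update_corner_supp hn hΛ hσ).1 n
    simp only [update_idem, update_self] at h
    exact h
  · exact hB _ (update_corner_supp hn hΛ hσ).1 (update_corner_supp hn hΛ hσ).2

include hΔ hc hcΔ hCΔ in
/-- **last-cube bound for a region `X`, `B` needed only above `X`**: as `BIJ88RegionCornerReduction309.abs_cornerSum_zG_le`.
[cite: BalabanImbrieJaffe1988, (5.13.3) p.305; (5.14.3) p.309] -/
theorem abs_cornerSum_zG_le_supp {f : I → (α → ℝ) → ℝ} (hf : ∀ i (φ ψ : α → ℝ), (∀ x, blk x = i → φ x = ψ x) → f i φ = f i ψ)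
    {X : Finset I} (hfm : AEStronglyMeasurable (fun ψ : α → ℝ => ∏ i ∈ X, f i ψ) volume)
    {K₀ : ℝ} (hK : ∀ ψ : α → ℝ, ‖∏ i ∈ X, f i ψ‖ ≤ K₀) {n : I} (hn : n ∈ X) {B : ℝ}
    (hB : ∀ s : I → ℝ, (∀ l, 0 ≤ s l ∧ s l ≤ 1) → (∀ l, l ∉ X → s l = 0) → |dexp blk Δ ℱ (fun ψ => ∏ i ∈ X, f i ψ) {n} s| ≤ B) :
    |cornerSum (zG blk Δ ℱ f X) X| ≤ 2 ^ (X.card - 1) * B := by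
  rw [cornerSum_zG_eq_univ_extend blk Δ ℱ hΔ f hf X]
  have hprod : ∀ ψ : α → ℝ, (∏ i, (if i ∈ X then f i else fun _ => (1 : ℝ)) ψ) = ∏ i ∈ X, f i ψ := fun ψ => by
    rw [← prod_filter_mul_prod_filter_not univ (· ∈ X)]
    have h1 : ∏ i ∈ univ.filter (· ∈ X), (if i ∈ X then f i else fun _ => (1 : ℝ)) ψ = ∏ i ∈ X, f i ψ := by
      rw [filter_mem_eq_inter, Finset.univ_inter]
      exact prod_congr rfl fun i hi => by rw [if_pos hi]
    have h2 : ∏ i ∈ univ.filter (fun i => ¬ i ∈ X), (if i ∈ X then f i else fun _ => (1 : ℝ)) ψ = 1 :=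
      prod_eq_one fun i hi => by rw [if_neg (mem_filter.1 hi).2]
    rw [h1, h2, mul_one]
  have hfm' : AEStronglyMeasurable (fun ψ : α → ℝ => ∏ i, (if i ∈ X then f i else fun _ => (1 : ℝ)) ψ) volume := by
    simp_rw [hprod]; exact hfm
  have hK' : ∀ ψ : α → ℝ, ‖∏ i, (if i ∈ X then f i else fun _ => (1 : ℝ)) ψ‖ ≤ K₀ := fun ψ => by rw [hprod]; exact hK ψ
  have hB' : ∀ s : I → ℝ, (∀ l, 0 ≤ s l ∧ s l ≤ 1) → (∀ l, l ∉ X → s l = 0) →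
      |dexp blk Δ ℱ (fun ψ => ∏ i, (if i ∈ X then f i else fun _ => (1 : ℝ)) ψ) {n} s| ≤ B := fun s hs hs0 => by
    simp_rw [hprod]; exact hB s hs hs0
  exact abs_cornerSum_zG_univ_le_supp blk ℱ hΔ hc hcΔ hCΔ hfm' hK' hn hB'

end LastCube

/-! ## §3 The located activity -/

section Activity

variable (adj : I → I → Prop) [DecidableRel adj]
variable (χ : CutoffProfile) {ι υ : Type*} [DecidableEq ι] [DecidableEq υ]
variable (p ek : ℝ) (B : Finset ι) (Φ : ι → (α → ℝ) → ℝ) (c : ι → ℝ) (Ys : Finset υ) (V : υ → (α → ℝ) → ℝ)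
variable (cube : ↥B ⊕ ↥Ys → I)

/-- **`|g₃(H, X″)| ≤ 2^{|X″|−1}·B` with `B` bounding `∂{n}⟨Π_{□_i⊂X″} fD_i⟩(s)` only for `s ∈ [0,1]^I` supported in `X″`** — p36 g18's
`BIJ88ActInLastCube309.abs_actIn_le_of_dexp_bound` in volume-uniform form. [cite: BalabanImbrieJaffe1988, (5.14.3)–(5.14.4) p.309; (5.13.3) p.305] -/
theorem abs_actIn_le_of_dexp_bound_supp (Λ X : Finset I) (t : ℝ) {L : Type*} [DecidableEq L]
    (γ : L → ↥(slotB B Ys cube X) ⊕ ↥(slotY B Ys cube X)) (H : Finset L) {X'' : Finset I} (h2 : 2 ≤ X''.card)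
    (hΔ : (interpForm blk Δ (corner ℝ Λ)).PosDef) {cl Cu : ℝ} (hcl : 0 < cl)
    (hclΔ : ∀ v, cl * (v ⬝ᵥ v) ≤ v ⬝ᵥ (interpForm blk Δ (corner ℝ Λ) *ᵥ v))
    (hCuΔ : ∀ v, v ⬝ᵥ (interpForm blk Δ (corner ℝ Λ) *ᵥ v) ≤ Cu * (v ⬝ᵥ v))
    (hf : ∀ i (φ ψ : α → ℝ), (∀ x, blk x = i → φ x = ψ x) →
      fD (uD χ p ek (slotB B Ys cube X) (fun b : ↥B => Φ b) (fun b : ↥B => c b) (slotY B Ys cube X) (fun Y : ↥Ys => V Y) t)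
        (cubeIn cube X) γ H i φ =
      fD (uD χ p ek (slotB B Ys cube X) (fun b : ↥B => Φ b) (fun b : ↥B => c b) (slotY B Ys cube X) (fun Y : ↥Ys => V Y) t)
        (cubeIn cube X) γ H i ψ)
    (hfm : AEStronglyMeasurable (fun ψ : α → ℝ => ∏ i ∈ X'',
      fD (uD χ p ek (slotB B Ys cube X) (fun b : ↥B => Φ b) (fun b : ↥B => c b) (slotY B Ys cube X) (fun Y : ↥Ys => V Y) t)
        (cubeIn cube X) γ H i ψ) volume)
    {K₀ : ℝ} (hK : ∀ ψ : α → ℝ, ‖∏ i ∈ X'',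
      fD (uD χ p ek (slotB B Ys cube X) (fun b : ↥B => Φ b) (fun b : ↥B => c b) (slotY B Ys cube X) (fun Y : ↥Ys => V Y) t)
        (cubeIn cube X) γ H i ψ‖ ≤ K₀)
    {n : I} (hn : n ∈ X'') {Bd : ℝ}
    (hB : ∀ s : I → ℝ, (∀ l, 0 ≤ s l ∧ s l ≤ 1) → (∀ l, l ∉ X'' → s l = 0) →
      |dexp blk (interpForm blk Δ (corner ℝ Λ)) ℱ (fun ψ => ∏ i ∈ X'',
        fD (uD χ p ek (slotB B Ys cube X) (fun b : ↥B => Φ b) (fun b : ↥B => c b) (slotY B Ys cube X) (fun Y : ↥Ys => V Y) t)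
          (cubeIn cube X) γ H i ψ) {n} s| ≤ Bd) :
    |actIn blk Δ ℱ adj χ p ek B Φ c Ys V cube Λ X t γ H X''| ≤ 2 ^ (X''.card - 1) * Bd := by
  have hBd : 0 ≤ Bd := le_trans (abs_nonneg _) (hB (fun _ => 0) (fun _ => ⟨le_rfl, zero_le_one⟩) (fun _ _ => rfl))
  simp only [actIn]
  rw [prime_of_not _ (fun h => by omega), g3, g1_of_two_le adj _ h2]
  split_ifs with hconn
  · rw [act]
    exact abs_cornerSum_zG_le_supp blk ℱ hΔ hcl hclΔ hCuΔ hf hfm hK hn hB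
  · rw [abs_zero]; positivity

end Activity

end Literature.MathematicalPhysics.QuantumFieldTheory.BalabanImbrieJaffe1984to88.BIJ88ActInLastCubeSupp309

end
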